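import Summits.ValiantsHypothesis.ValiantsHypothesis.Theorems.BarrierLeverModelAxisCapstone

/-!
# Route BarrierLever — the MODEL axis of crux `DefinableEquations` (stmt-ValiantsHypothesis-8745) /
# item `SingleSizeEquations` (8749): the walls — each model-axis certificate is REFUTED as an
# equation for the crux's class `SmallCircuits ℂ n 2` by an explicit small circuit

The model-axis certificates vanish on their slices at a level independent of the size exponent;
here we record, kernel-checked, that none of them is an equation for general small circuits — the
gap between the slices and the crux (`SmallCircuits ℂ n b`, Chatterjee–Tengse 2023 §1.3 dir. 2) is
witnessed by explicit polynomials of circuit size `≤ n²` and degree `≤ n`: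

* `sumSqPow n = (Σ_i x_i²)^k`, `k = ⌊n/9⌋` — size `≤ ⌊n/9⌋(2n+1) ≤ n²` — is a NON-root of the
  order-`k` square-free catalecticant `spsCert n` (its matrix is diagonal by parity, with the
  positive diagonal entries `2^k · #{orderings}`): `spsCert_separates`; hence
  `sumSqPow_not_mem_sigmaPiSigmaSlice` — a power of the quadric is not a sum of fewer than
  `C(n,k)/C(2k,k) ≥ 2^{⌊n/9⌋}` products of linear forms (nor of `≤ 2k` affine forms): a homogeneous
  `ΣΠΣ` lower bound for a size-`n²` member of VP, kernel-checked;
* `sqWitness n = ∏_{i<⌊n/2⌋} (1 + x_i²)` (size `≤ 2n`) is a non-root of the Sylvester catalecticant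
  `slsCert n` of the `ΣΛΣ` files: `slsCert_separates`;
* `cutWitness A = ∏_j (1 + x_{ρ_A j} x_{κ_A j})` (size `≤ 2n`) makes Nisan's cut factor
  `det (cutMatrix n A)` equal to `1`: `det_cutMatrix_separates` (each FACTOR of `nisanCert` is
  refuted; the product itself vanishes at `cutWitness A` through the other cuts).
So `¬ IsNaturalProof … (SmallCircuits ℂ n 2) 𝒟 (spsCert n)` etc. for every `𝒟`
(`not_isNaturalProof_spsCert_smallCircuits`, `…slsCert…`, `…det_cutMatrix…`).
WHAT THIS IS NOT: not a barrier theorem (it refutes these particular certificates, not all level-`a`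
distinguishers — that would be `SuccinctHittingSetsForVP`, crux 14610); nothing on VP vs VNP.
-/

-- layout Summits/ValiantsHypothesis/ValiantsHypothesis forces the duplicated namespace component
set_option linter.dupNamespace false

noncomputable section

open MvPolynomial Finsupp

namespace Summit.ValiantsHypothesis.ValiantsHypothesis.Theorems.BarrierLever.ModelAxis

open Literature.Computability.AlgebraicComplexity Literature.Barriers.ValiantsHypothesis
open SigmaLambdaSigmaSlice SigmaPiSigmaSlice ROABPSlice

section walls

variable {n : ℕ}

/-! ## Small circuits: sizes of powers and of products of binomials -/

/-- `L(f^m) ≤ m (L(f) + 1)`. [cite: Burgisser2000, §2.1] -/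
theorem complexity_pow_le (f : MvPolynomial (Fin n) ℂ) :
    ∀ m : ℕ, complexity (f ^ m) ≤ m * (complexity f + 1)
  | 0 => by
    rw [pow_zero, zero_mul, ← C_1, complexity_C_holds]
  | m + 1 => by
    calc complexity (f ^ (m + 1)) = complexity (f ^ m * f) := by rw [pow_succ]
      _ ≤ complexity (f ^ m) + complexity f + 1 := complexity_mul_le_holds _ _
      _ ≤ m * (complexity f + 1) + complexity f + 1 :=
          Nat.add_le_add_right (Nat.add_le_add_right (complexity_pow_le f m) _) _
      _ = (m + 1) * (complexity f + 1) := by ring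

/-- A product of `m` factors of size `≤ 2` has size `≤ 3m`. [cite: Burgisser2000, §2.1] -/
theorem complexity_prod_le_three_mul {ι : Type*} (s : Finset ι) (g : ι → MvPolynomial (Fin n) ℂ)
    (hg : ∀ i ∈ s, complexity (g i) ≤ 2) : complexity (∏ i ∈ s, g i) ≤ 3 * s.card := by
  calc complexity (∏ i ∈ s, g i) ≤ ∑ i ∈ s, complexity (g i) + s.card :=
        complexity_finset_prod_le _ _
    _ ≤ ∑ _i ∈ s, 2 + s.card := Nat.add_le_add_right (Finset.sum_le_sum hg) _
    _ = 3 * s.card := by rw [Finset.sum_const, smul_eq_mul]; ring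

/-- `3 ⌊n/2⌋ ≤ n²`. [folklore] -/
theorem three_mul_half_le_sq (n : ℕ) : 3 * (n / 2) ≤ n ^ 2 := by
  rcases Nat.lt_or_ge n 2 with h | h
  · rw [Nat.div_eq_of_lt h]
    exact Nat.zero_le _
  · have h1 : 2 * (n / 2) ≤ n := Nat.mul_div_le n 2
    have h2 : 2 * n ≤ n * n := Nat.mul_le_mul_right n h
    rw [sq]
    omega

/-- `L(1 + u v) ≤ 2` for variables (or squares of variables) `u, v`. [folklore] -/
theorem complexity_one_add_X_mul_X_le (u v : Fin n) :
    complexity (1 + (X u * X v : MvPolynomial (Fin n) ℂ)) ≤ 2 := by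
  have h1 : complexity (1 : MvPolynomial (Fin n) ℂ) = 0 := by rw [← C_1, complexity_C_holds]
  have h2 := complexity_mul_le_holds (X u : MvPolynomial (Fin n) ℂ) (X v)
  rw [complexity_X_holds, complexity_X_holds] at h2
  have h3 := complexity_add_le_holds (1 : MvPolynomial (Fin n) ℂ) (X u * X v)
  omega

/-! ## The power of the quadric versus the homogeneous `ΣΠΣ` certificate -/

variable (n) in
/-- `(x_0² + ⋯ + x_{n-1}²)^{⌊n/9⌋}` (degree `2⌊n/9⌋ ≤ n`, circuit size `≤ ⌊n/9⌋(2n+1)`).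
[folklore] -/
def sumSqPow : MvPolynomial (Fin n) ℂ := (∑ i : Fin n, X i ^ 2) ^ (n / 9)

/-- `L(Σ_i x_i²) ≤ 2n`. [folklore] -/
theorem complexity_sumSq_le : complexity (∑ i : Fin n, (X i : MvPolynomial (Fin n) ℂ) ^ 2) ≤ 2 * n := by
  have h1 : ∀ i : Fin n, complexity ((X i : MvPolynomial (Fin n) ℂ) ^ 2) ≤ 1 := fun i => by
    calc complexity ((X i : MvPolynomial (Fin n) ℂ) ^ 2) = complexity (X i * X i) := by rw [sq]
      _ ≤ complexity (X i : MvPolynomial (Fin n) ℂ) + complexity (X i : MvPolynomial (Fin n) ℂ) + 1 :=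
          complexity_mul_le_holds _ _
      _ = 1 := by rw [complexity_X_holds]
  calc complexity (∑ i : Fin n, (X i : MvPolynomial (Fin n) ℂ) ^ 2)
      ≤ ∑ i : Fin n, complexity ((X i : MvPolynomial (Fin n) ℂ) ^ 2) +
          (Finset.univ : Finset (Fin n)).card := complexity_finset_sum_le _ _
    _ ≤ ∑ _i : Fin n, 1 + (Finset.univ : Finset (Fin n)).card :=
        Nat.add_le_add_right (Finset.sum_le_sum fun i _ => h1 i) _
    _ = 2 * n := by rw [Finset.sum_const, Finset.card_univ, Fintype.card_fin, smul_eq_mul]; ring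

/-- **The power of the quadric is a small circuit of low degree**: `sumSqPow n ∈ SmallCircuits ℂ n 2`.
[folklore] -/
theorem sumSqPow_mem_smallCircuits : sumSqPow n ∈ SmallCircuits ℂ n 2 := by
  refine ⟨?_, ?_⟩
  · rw [sumSqPow]
    refine (totalDegree_pow _ _).trans ?_
    have h2 : (∑ i : Fin n, (X i : MvPolynomial (Fin n) ℂ) ^ 2).totalDegree ≤ 2 :=
      (totalDegree_finsetSum _ _).trans (Finset.sup_le fun i _ =>
        (totalDegree_pow _ _).trans (by rw [totalDegree_X]))
    calc n / 9 * (∑ i : Fin n, (X i : MvPolynomial (Fin n) ℂ) ^ 2).totalDegree ≤ n / 9 * 2 :=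
          Nat.mul_le_mul_left _ h2
      _ ≤ n := by omega
  · rw [sumSqPow]
    calc complexity ((∑ i : Fin n, (X i : MvPolynomial (Fin n) ℂ) ^ 2) ^ (n / 9))
        ≤ n / 9 * (complexity (∑ i : Fin n, (X i : MvPolynomial (Fin n) ℂ) ^ 2) + 1) :=
          complexity_pow_le _ _
      _ ≤ n / 9 * (2 * n + 1) := Nat.mul_le_mul_left _ (Nat.add_le_add_right complexity_sumSq_le 1)
      _ ≤ n ^ 2 := by
          have h9 : 9 * (n / 9) ≤ n := Nat.mul_div_le n 9
          nlinarith

/-- Expansion of the power of the quadric into monomials `x^{2φ}` over maps `φ : Fin k → Fin n`.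
[folklore] -/
theorem sumSqPow_eq_sum : sumSqPow n =
    ∑ φ : Fin (n / 9) → Fin n, monomial (∑ l : Fin (n / 9), Finsupp.single (φ l) 2) 1 := by
  rw [sumSqPow, Fintype.sum_pow]
  refine Finset.sum_congr rfl fun φ _ => ?_
  rw [monomial_sum_one]
  exact Finset.prod_congr rfl fun l _ => by rw [X_pow_eq_monomial]

/-- Parity: the exponents `Σ_l 2 e_{φ l}` are even in every coordinate. [folklore] -/
theorem two_dvd_sum_single_apply (φ : Fin (n / 9) → Fin n) (v : Fin n) :
    2 ∣ (∑ l : Fin (n / 9), Finsupp.single (φ l) 2) v := by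
  rw [Finsupp.finsetSum_apply]
  exact Finset.dvd_sum fun l _ => by
    rw [Finsupp.single_apply]
    split_ifs <;> simp

/-- Off the diagonal the coefficients vanish: `x^S x^T` with `S ≠ T` has an odd exponent.
[folklore] -/
theorem coeff_sumSqPow_eq_zero {S T : KSub n} (hST : S ≠ T) :
    coeff (sqfree T.1 + sqfree S.1) (sumSqPow n) = 0 := by
  classical
  rw [sumSqPow_eq_sum, coeff_sum]
  refine Finset.sum_eq_zero fun φ _ => ?_
  rw [coeff_monomial, if_neg]
  intro h
  apply hST
  apply Subtype.ext
  ext v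
  have h2 := two_dvd_sum_single_apply φ v
  rw [h, Finsupp.add_apply, sqfree_apply, sqfree_apply] at h2
  by_cases hT : v ∈ T.1 <;> by_cases hS : v ∈ S.1 <;> simp [hT, hS] at h2 ⊢

/-- On the diagonal the coefficients are positive integers (the number of orderings of `S`), in
particular nonzero. [folklore] -/
theorem coeff_sumSqPow_ne_zero (S : KSub n) :
    coeff (sqfree S.1 + sqfree S.1) (sumSqPow n) ≠ 0 := by
  classical
  rw [sumSqPow_eq_sum, coeff_sum]
  simp only [coeff_monomial]
  rw [Finset.sum_boole, Nat.cast_ne_zero, ← Nat.pos_iff_ne_zero, Finset.card_pos]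
  -- an ordering of `S` is a map with the right exponent
  let e : Fin (n / 9) ≃ S.1 := (S.1.equivFin.trans (finCongr S.2)).symm
  refine ⟨fun l => (e l).1, Finset.mem_filter.mpr ⟨Finset.mem_univ _, ?_⟩⟩
  have key : ∑ l : Fin (n / 9), Finsupp.single ((e l).1) (2 : ℕ) =
      ∑ v ∈ S.1.attach, Finsupp.single v.1 2 := by
    rw [← Finset.sum_coe_sort_eq_attach]
    exact e.sum_comp (fun v : S.1 => Finsupp.single v.1 (2 : ℕ))
  rw [key, Finset.sum_attach S.1 (fun v => Finsupp.single v (2 : ℕ)), sqfree,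
    ← Finset.sum_add_distrib]
  exact Finset.sum_congr rfl fun v _ => by rw [← Finsupp.single_add]

/-- **The order-`k` catalecticant does not vanish at the power of the quadric** (its matrix there
is diagonal with nonzero entries). [folklore] -/
theorem eval_spsCert_sumSqPow_ne_zero :
    eval (coeffVector (degLEMonomials n) (sumSqPow n)) (spsCert n) ≠ 0 := by
  classical
  rw [eval_spsCert]
  have hM : (Matrix.of fun S T => (spsWeight n S T : ℂ) *
      coeffVector (degLEMonomials n) (sumSqPow n) (spsCoord n S T)) =
      Matrix.diagonal fun S => (spsWeight n S S : ℂ) *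
        coeff (sqfree S.1 + sqfree S.1) (sumSqPow n) := by
    ext S T
    rw [Matrix.of_apply, coeffVector_apply, Matrix.diagonal_apply]
    show (spsWeight n S T : ℂ) * coeff (sqfree T.1 + sqfree S.1) (sumSqPow n) = _
    split_ifs with h
    · subst h; rfl
    · rw [coeff_sumSqPow_eq_zero h, mul_zero]
  rw [hM, Matrix.det_diagonal]
  exact Finset.prod_ne_zero_iff.mpr fun S _ =>
    mul_ne_zero (spsWeight_self_ne_zero S) (coeff_sumSqPow_ne_zero S)

/-- **The homogeneous-`ΣΠΣ` certificate separates its slices from `SmallCircuits ℂ n 2`**: an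
explicit size-`n²`, degree-`≤ n` polynomial at which `spsCert n` does not vanish. [folklore] -/
theorem spsCert_separates :
    sumSqPow n ∈ SmallCircuits ℂ n 2 ∧
      eval (coeffVector (degLEMonomials n) (sumSqPow n)) (spsCert n) ≠ 0 :=
  ⟨sumSqPow_mem_smallCircuits, eval_spsCert_sumSqPow_ne_zero⟩

/-- Hence `spsCert n` is not a natural proof against `SmallCircuits ℂ n 2`, whatever the
distinguisher class. [cite: ForbesShpilkaVolk2018, Def. 1] -/
theorem not_isNaturalProof_spsCert_smallCircuits (𝒟 : Set (MvPolynomial (degLEMonomials n) ℂ)) :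
    ¬ IsNaturalProof (degLEMonomials n) (SmallCircuits ℂ n 2) 𝒟 (spsCert n) :=
  fun h => eval_spsCert_sumSqPow_ne_zero (h.2.2 _ sumSqPow_mem_smallCircuits)

/-- **A homogeneous `ΣΠΣ` lower bound for a member of VP, kernel-checked**: `(Σ_i x_i²)^{⌊n/9⌋}`
is not a sum of at most `s` products of linear forms whenever `s · C(2k,k) < C(n,k)` (e.g. for
every `s < 2^{⌊n/9⌋}`), nor a sum of at most `s` products of `≤ 2⌊n/9⌋` affine forms.
[cite: NisanWigderson1996, §3 (Theorem 0)] -/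
theorem sumSqPow_not_mem_sigmaPiSigmaSlice {s : ℕ}
    (hs : s * (2 * (n / 9)).choose (n / 9) < n.choose (n / 9)) :
    sumSqPow n ∉ sigmaPiSigmaSlice n s ∧ sumSqPow n ∉ sigmaPiSigmaLowDegSlice n s :=
  ⟨fun hf => eval_spsCert_sumSqPow_ne_zero (eval_spsCert_eq_zero_of_mem hs hf),
    fun hf => eval_spsCert_sumSqPow_ne_zero (eval_spsCert_eq_zero_of_mem_lowDeg hs hf)⟩

/-! ## The `ΣΛΣ` certificate versus `∏_{i<⌊n/2⌋} (1 + x_i²)` -/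

/-- Product form of the `ΣΛΣ` witness: `sqWitness n = ∏_{i<⌊n/2⌋} (1 + x_i²)`. [folklore] -/
theorem sqWitness_eq_prod :
    sqWitness n = ∏ i : Fin (n / 2), (1 + (X (halfEmb n i) : MvPolynomial (Fin n) ℂ) ^ 2) := by
  classical
  rw [Finset.prod_one_add, Finset.powerset_univ, sqWitness]
  refine Finset.sum_congr rfl fun S _ => ?_
  rw [show ind n S + ind n S = ∑ i ∈ S, Finsupp.single (halfEmb n i) 2 by
    rw [ind, sqfree, Finset.sum_map, ← Finset.sum_add_distrib]
    exact Finset.sum_congr rfl fun i _ => by rw [← Finsupp.single_add], monomial_sum_one]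
  exact Finset.prod_congr rfl fun i _ => by rw [X_pow_eq_monomial]

/-- `sqWitness n ∈ SmallCircuits ℂ n 2` (size `≤ 3⌊n/2⌋ ≤ n²`). [folklore] -/
theorem sqWitness_mem_smallCircuits : sqWitness n ∈ SmallCircuits ℂ n 2 := by
  refine ⟨totalDegree_sqWitness_le, ?_⟩
  rw [sqWitness_eq_prod]
  refine (complexity_prod_le_three_mul _ _ fun i _ => ?_).trans ?_
  · rw [sq]
    exact complexity_one_add_X_mul_X_le _ _
  · rw [Finset.card_univ, Fintype.card_fin]
    exact three_mul_half_le_sq n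

/-- **The `ΣΛΣ` certificate separates its slice from `SmallCircuits ℂ n 2`.** [folklore] -/
theorem slsCert_separates :
    sqWitness n ∈ SmallCircuits ℂ n 2 ∧
      eval (coeffVector (degLEMonomials n) (sqWitness n)) (slsCert n) ≠ 0 :=
  ⟨sqWitness_mem_smallCircuits, eval_slsCert_sqWitness_ne_zero⟩

/-- Hence `slsCert n` is not a natural proof against `SmallCircuits ℂ n 2`.
[cite: ForbesShpilkaVolk2018, Def. 1] -/
theorem not_isNaturalProof_slsCert_smallCircuits
    (𝒟 : Set (MvPolynomial (degLEMonomials n) ℂ)) :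
    ¬ IsNaturalProof (degLEMonomials n) (SmallCircuits ℂ n 2) 𝒟 (slsCert n) :=
  fun h => eval_slsCert_sqWitness_ne_zero (h.2.2 _ sqWitness_mem_smallCircuits)

/-! ## Nisan's cut factors versus `∏_j (1 + x_{ρ j} x_{κ j})` -/

/-- Product form of the cut witness: `cutWitness A = ∏_j (1 + x_{ρ_A j} x_{κ_A j})`. [folklore] -/
theorem cutWitness_eq_prod (A : Cut n) :
    cutWitness n A = ∏ j : Fin (n / 2),
      (1 + (X (rowEmb A j) * X (colEmb A j) : MvPolynomial (Fin n) ℂ)) := by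
  classical
  rw [Finset.prod_one_add, Finset.powerset_univ, cutWitness]
  refine Finset.sum_congr rfl fun U _ => ?_
  rw [show sqfree (U.map (colEmb A)) + sqfree (U.map (rowEmb A)) =
      ∑ j ∈ U, (Finsupp.single (rowEmb A j) 1 + Finsupp.single (colEmb A j) 1) by
    rw [sqfree, sqfree, Finset.sum_map, Finset.sum_map, ← Finset.sum_add_distrib]
    exact Finset.sum_congr rfl fun j _ => by rw [add_comm], monomial_sum_one]
  exact Finset.prod_congr rfl fun j _ => by rw [X, X, monomial_mul, one_mul]

/-- `cutWitness A ∈ SmallCircuits ℂ n 2` (size `≤ 3⌊n/2⌋ ≤ n²`). [folklore] -/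
theorem cutWitness_mem_smallCircuits (A : Cut n) : cutWitness n A ∈ SmallCircuits ℂ n 2 := by
  refine ⟨totalDegree_cutWitness_le A, ?_⟩
  rw [cutWitness_eq_prod]
  refine (complexity_prod_le_three_mul _ _ fun j _ => complexity_one_add_X_mul_X_le _ _).trans ?_
  rw [Finset.card_univ, Fintype.card_fin]
  exact three_mul_half_le_sq n

/-- **Each cut factor of Nisan's certificate is refuted as an equation for `SmallCircuits ℂ n 2`**:
at the size-`n²` polynomial `cutWitness A` the factor of `A` evaluates to `1`. [folklore] -/
theorem det_cutMatrix_separates (A : Cut n) :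
    cutWitness n A ∈ SmallCircuits ℂ n 2 ∧
      eval (coeffVector (degLEMonomials n) (cutWitness n A)) (cutMatrix n A).det = 1 :=
  ⟨cutWitness_mem_smallCircuits A, by rw [eval_det_cutMatrix, det_cutMatrix_cutWitness]⟩

/-- Hence no cut factor is a natural proof against `SmallCircuits ℂ n 2`.
[cite: ForbesShpilkaVolk2018, Def. 1] -/
theorem not_isNaturalProof_det_cutMatrix_smallCircuits (A : Cut n)
    (𝒟 : Set (MvPolynomial (degLEMonomials n) ℂ)) :
    ¬ IsNaturalProof (degLEMonomials n) (SmallCircuits ℂ n 2) 𝒟 (cutMatrix n A).det := fun h => by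
  have h1 := h.2.2 _ (cutWitness_mem_smallCircuits A)
  rw [(det_cutMatrix_separates A).2] at h1
  exact one_ne_zero h1

end walls

end Summit.ValiantsHypothesis.ValiantsHypothesis.Theorems.BarrierLever.ModelAxis

end
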